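import Literature.NumberTheory.Automorphic.ArchEndoscopicChartTorusRange        -- ★ (LH2-p04 (g3)): `exists_endoTorus_eq_iff`, `isClosed_range_endoTorusHom`, `mem_chartTorusH_iff`; brings ★ (T-MEAS) `chartTorusH`, ★ atlas `endoBlock`
import Literature.NumberTheory.Automorphic.ArchEndoscopicCartanAtlasCentralizer  -- ★ p849714 (CENT-H): `exists_eq_circleDiagonal_one` (every element of `U(Φ₁)_w` is `e^{iφ}`)
import Literature.NumberTheory.Automorphic.ArchLocalRegularOrbitClosed           -- ★ `locallyCompactSpace_archLocal`, `secondCountableTopology_archLocal`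
import Literature.MeasureTheory.Group.InvariantQuotientConjugacySum              -- ★ `descConj γ M _ f : G ⧸ M → E`
import HarnessLib

/-!
# The ONE-PLACE chart `endoBlockAt S w` and chart torus `T_{S,w} ≤ U(Φ₂)_w`; the chart torus `T_S` of `H_∞` is placewise
# ((PROD-QUOT-H) FILE D1 of the LH3 direct road: Rogawski 1990 §3.6, §8.2; Shelstad 1979 §4; Borel–Jacquet 1979 §4.1)

Topic `NumberTheory/Automorphic`; namespace `Literature.NumberTheory.Automorphic.UnitaryGroup`.  DEFINITIONS WITH BODIES (`endoBlockAt`, `endoBlockAtHom`,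
`chartTorusHLoc`, `chartBoxLoc`, `chartBoxImgLoc`) + theorems; no instance, no notation, no axiom, no named fact, no `sorry`.  Cell `pub/hodgecm-mathlib`, crux H413
(`stmt-HodgeConjecture-24833`), F0∕P3c line LH3 (closer stub `stub_N9`, DIRECT ROAD), organ «(PROD-QUOT-H)» (LH3-plan (g2) deal 2026-09-02T06:53:06Z to LH3-p03 (g3)):
the factorisation of the chart orbital functional ★ `chartOrbH` of `H_∞ = U(Φ₂)(L⁺ ⊗ ℝ) × U(Φ₁)(L⁺ ⊗ ℝ) ≃ Π_w (U(Φ₂)_w × U(Φ₁)_w)` over the complex places `w`.  THIS FILE is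
the local vocabulary, part 1: what ★ (T-ATLAS)∕(T-MEAS) do for the global chart `c ↦ endoTorus S c ∈ H_∞` and its torus `T_S`, done at ONE place `w` for the `U(Φ₂)_w`-block
`cw ↦ endoBlockAt S w cw ∈ U(Φ₂)_w` and its torus `T_{S,w}` (the `U(Φ₁)_w = U(1)` factor is abelian and carries no orbital integral), and the theorem that `T_S` is
PLACEWISE.  Part 2 (`ArchEndoscopicChartOrbLocal`: the local Haar ∕ quotient measures and the local chart orbital functional `chartOrbHLoc`) and the factorisation
theorems (`ArchEndoscopicChartTorusPlaces`, `ArchEndoscopicChartOrbPlaces`) are the sibling files; count-neutral.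

* §1 **`endoBlockAt L S w cw : U(Φ₂)_w`** — the local chart (split block `diag(e^{x+iθ}, e^{−x+iθ})`, `x = cw 0`, `θ = cw 2`, at `w ∈ S`; Cayley circle block at
  `w ∉ S`); `endoBlock_eq_endoBlockAt : endoBlock L S c w = endoBlockAt L S w (c w)` (rfl); additive (`endoBlockAt_add ∕ _zero ∕ _neg ∕ _comm`), continuous, reads only the
  slots `0, 2` (`endoBlockAt_congr`); packaged as the hom `endoBlockAtHom S w : Multiplicative (Fin 3 → ℝ) →* U(Φ₂)_w`.
* §2 **`chartTorusHLoc L S w ≤ U(Φ₂)_w`** := the topological closure of the range of the local chart (as ★ `chartTorusH`); closed, abelian, `≤` the centraliser of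
  every local chart point, `forall_mem_chartTorusHLoc_comm` (the ★ `descConj` binder), locally compact, `continuous_descConj_endoBlockAt`; the local box `chartBoxLoc S w`
  (`x ∈ [0,1]` at a split place, angles in `[0, 2π]`) with **`chartBox_eq_pi_chartBoxLoc : chartBox S = pi univ (chartBoxLoc S)`** (rfl) and its compact image
  `chartBoxImgLoc S w ⊆ T_{S,w}` (`1 ∈` it); **`isClosed_range_endoBlockAtHom`**, **`chartTorusHLoc_eq_range`**, **`mem_chartTorusHLoc_iff : g ∈ T_{S,w} ↔ ∃ cw,
  endoBlockAt S w cw = g`** — from the GLOBAL closed-range theorem ★ `isClosed_range_endoTorusHom` through the continuous insertion `g ↦ (e⁻¹(mulSingle w g), 1)`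
  (`endoTorus_update_zero`); no matrix analysis is redone.
* §3 **THE CHART TORUS IS PLACEWISE**: `mem_chartTorusH_iff_forall_mem_chartTorusHLoc : h ∈ T_S ↔ ∀ w, (e h.1) w ∈ T_{S,w}` (`e = archPiEquivCM 2 L Φ₂`; NO condition on
  the `U(Φ₁)`-component `h.2`, ★ `exists_eq_circleDiagonal_one`), `mem_chartTorusH_iff_of_fst_eq`, `one_prod_mem_chartTorusH` — the algebraic content of
  «`T_S = (Π_w T_{S,w}) × U(Φ₁)_∞`», which kills the `U(Φ₁)`-factor in `H_∞ ⧸ T_S` and makes the quotient a product over the places.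
HONEST LABEL: HC_CM is proved only modulo the 7 printed citations (2 remaining: hLiu418 = `stmt-HodgeConjecture-24832`, h413 = `stmt-HodgeConjecture-24833`) until rung 0
closes; chart bookkeeping, moves no row of the books.

## References
* [Rogawski1990] J. D. Rogawski, *Automorphic Representations of Unitary Groups in Three Variables*, Ann. of Math. Stud. 123 (1990), §3.6 p. 31, §4.9 p. 54, §8.2–8.3 pp. 122–124.
* [Shelstad1979] D. Shelstad, *Characters and inner forms of a quasi-split group over ℝ*, Compositio Math. 39 (1979), §4 pp. 22–23 (`T`, `dt`, `Φ^T_f`).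
* [Folland1995] G. B. Folland, *A Course in Abstract Harmonic Analysis* (1995), §2.2 (Haar measure), §2.6 Thm. 2.49 (products).
* [BorelJacquet1979] A. Borel, H. Jacquet, *Automorphic forms and automorphic representations*, PSPM 33.1 (1979), §4.1 (`G_∞ = Π_v G(F_v)`).
-/

set_option autoImplicit false

noncomputable section

open NumberField NumberField.InfinitePlace Matrix Complex Topology
open Literature.MeasureTheory.Group
open scoped MatrixGroups Matrix Classical

namespace Literature.NumberTheory.Automorphic.UnitaryGroup

/-! ## §1 The local chart `endoBlockAt S w` of `U(Φ₂)_w` -/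

section LocalChart

variable (L : Type) [Field L] (S : Finset {w : InfinitePlace L // IsComplex w}) (w : {w : InfinitePlace L // IsComplex w})

/-- **THE LOCAL CHART `cw ↦ endoBlockAt S w cw ∈ U(Φ₂)_w`** — the `U(Φ₂)_w`-block of the chart `S` as a function of the three LOCAL coordinates `cw : Fin 3 → ℝ` (it reads
`cw 0` and `cw 2`): the split block `diag(e^{cw 0 + i cw 2}, e^{−cw 0 + i cw 2})` at `w ∈ S`, the Cayley circle block `P·diag(e^{i cw 0}, e^{i cw 2})·P⁻¹` at `w ∉ S`
(★ `endoBlock` at the constant coordinate family). [cite: Rogawski1990, §3.6 p. 31; §8.2 p. 122] [cite: Shelstad1979, §4 p. 22] -/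
def endoBlockAt (cw : Fin 3 → ℝ) : ↥(archLocal L 2 (Matrix.of fun i j : Fin 2 => if i.val + j.val + 1 = 2 then (1 : L) else 0) w) :=
  endoBlock L S (fun _ => cw) w

/-- **The global chart's `w`-block IS the local chart at `c w`** (definitional: ★ `endoBlock S c w` reads `c w 0`, `c w 2` only). [cite: Rogawski1990, §8.2 p. 122] -/
theorem endoBlock_eq_endoBlockAt (c : {w : InfinitePlace L // IsComplex w} → Fin 3 → ℝ) : endoBlock L S c w = endoBlockAt L S w (c w) := rfl

/-- `endoBlockAt` at the constant family (definitional). [cite: Rogawski1990, §8.2 p. 122] -/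
theorem endoBlockAt_eq_endoBlock (cw : Fin 3 → ℝ) : endoBlockAt L S w cw = endoBlock L S (fun _ => cw) w := rfl

/-- **The local chart is additive**: `endoBlockAt S w (cw + cw′) = endoBlockAt S w cw · endoBlockAt S w cw′` (★ `endoBlock_add`). [cite: Rogawski1990, §3.6 p. 31] -/
theorem endoBlockAt_add (cw cw' : Fin 3 → ℝ) : endoBlockAt L S w (cw + cw') = endoBlockAt L S w cw * endoBlockAt L S w cw' :=
  endoBlock_add L S (fun _ => cw) (fun _ => cw') w

/-- `endoBlockAt S w 0 = 1` (★ `endoBlock_zero`). [cite: Rogawski1990, §3.6 p. 31] -/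
theorem endoBlockAt_zero : endoBlockAt L S w 0 = 1 :=
  endoBlock_zero L S w

/-- `endoBlockAt S w (−cw) = (endoBlockAt S w cw)⁻¹`. [cite: Rogawski1990, §3.6 p. 31] -/
theorem endoBlockAt_neg (cw : Fin 3 → ℝ) : endoBlockAt L S w (-cw) = (endoBlockAt L S w cw)⁻¹ := by
  have h := endoBlockAt_add L S w cw (-cw)
  rw [add_neg_cancel, endoBlockAt_zero] at h
  exact eq_inv_of_mul_eq_one_right h.symm

/-- **Local chart points commute.** [cite: Rogawski1990, §3.6 p. 31] -/
theorem endoBlockAt_comm (cw cw' : Fin 3 → ℝ) : endoBlockAt L S w cw * endoBlockAt L S w cw' = endoBlockAt L S w cw' * endoBlockAt L S w cw := by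
  rw [← endoBlockAt_add, ← endoBlockAt_add, add_comm]

/-- **The local chart is continuous** (★ `continuous_hypBlockGL`, `continuous_circleDiagonal`; the `if` is on the fixed datum `w ∈ S`). [cite: Rogawski1990, §8.2 p. 122] -/
theorem continuous_endoBlockAt : Continuous (endoBlockAt L S w) := by
  by_cases hw : w ∈ S
  · have h : (endoBlockAt L S w) = fun cw => ⟨hypBlockGL (cw 0) (cw 2), hypBlockGL_mem_archLocal L w (cw 0) (cw 2)⟩ := by
      funext cw; unfold endoBlockAt endoBlock; rw [if_pos hw]
    rw [h]
    refine Continuous.subtype_mk ?_ _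
    have hc : Continuous fun cw : Fin 3 → ℝ => ((cw 0, cw 2) : ℝ × ℝ) := (continuous_apply 0).prodMk (continuous_apply 2)
    exact continuous_hypBlockGL.comp hc
  · have h : (endoBlockAt L S w) = fun cw => ⟨Matrix.GeneralLinearGroup.mkOfDetNeZero !![(1 : ℂ), 1; 1, -1] det_cayleyTwo_ne_zero *
          circleDiagonal 2 ![Circle.exp (cw 0), Circle.exp (cw 2)] *
        (Matrix.GeneralLinearGroup.mkOfDetNeZero !![(1 : ℂ), 1; 1, -1] det_cayleyTwo_ne_zero)⁻¹,
        cayley_conj_circleDiagonal_mem_archLocal L w _⟩ := by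
      funext cw; unfold endoBlockAt endoBlock; rw [if_neg hw]
    rw [h]
    refine Continuous.subtype_mk ?_ _
    have hv : Continuous fun cw : Fin 3 → ℝ => ![Circle.exp (cw 0), Circle.exp (cw 2)] := by
      have h0 : Continuous fun cw : Fin 3 → ℝ => Circle.exp (cw 0) := Circle.exp.continuous.comp (continuous_apply 0)
      have h2 : Continuous fun cw : Fin 3 → ℝ => Circle.exp (cw 2) := Circle.exp.continuous.comp (continuous_apply 2)
      exact continuous_pi fun i => by fin_cases i <;> assumption
    exact (continuous_const.mul ((continuous_circleDiagonal 2).comp hv)).mul continuous_const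

/-- **The local chart as a monoid homomorphism** `Multiplicative (Fin 3 → ℝ) →* U(Φ₂)_w`. [cite: Rogawski1990, §3.6 p. 31] [cite: Shelstad1979, §4 p. 22] -/
def endoBlockAtHom : Multiplicative (Fin 3 → ℝ) →* ↥(archLocal L 2 (Matrix.of fun i j : Fin 2 => if i.val + j.val + 1 = 2 then (1 : L) else 0) w) where
  toFun cw := endoBlockAt L S w (Multiplicative.toAdd cw)
  map_one' := endoBlockAt_zero L S w
  map_mul' a b := endoBlockAt_add L S w (Multiplicative.toAdd a) (Multiplicative.toAdd b)

/-- `endoBlockAtHom S w (ofAdd cw) = endoBlockAt S w cw` (definitional). [cite: Rogawski1990, §3.6 p. 31] -/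
@[simp] theorem endoBlockAtHom_apply (cw : Multiplicative (Fin 3 → ℝ)) : endoBlockAtHom L S w cw = endoBlockAt L S w (Multiplicative.toAdd cw) := rfl

/-- **The local chart reads only the slots `0` and `2`**: `endoBlockAt S w cw = endoBlockAt S w cw′` whenever `cw 0 = cw′ 0` and `cw 2 = cw′ 2`.
[cite: Rogawski1990, §8.2 p. 122] -/
theorem endoBlockAt_congr {cw cw' : Fin 3 → ℝ} (h0 : cw 0 = cw' 0) (h2 : cw 2 = cw' 2) : endoBlockAt L S w cw = endoBlockAt L S w cw' := by
  unfold endoBlockAt endoBlock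
  simp only [h0, h2]

end LocalChart

/-! ## §2 The local chart torus `T_{S,w} ≤ U(Φ₂)_w`, its box, and the range theorem -/

section LocalTorus

variable (L : Type) [Field L] (S : Finset {w : InfinitePlace L // IsComplex w}) (w : {w : InfinitePlace L // IsComplex w})

/-- **The local chart torus `T_{S,w} ≤ U(Φ₂)_w`** — the (closure of the) range of the local chart `cw ↦ endoBlockAt S w cw`: the split diagonal torus at `w ∈ S`, the
compact Cayley circle torus at `w ∉ S`.  (The range is closed — `chartTorusHLoc_eq_range` below — so this IS the range; the closure only makes `IsClosed` definitional,
as in ★ `chartTorusH`.) [cite: Rogawski1990, §3.6 p. 31; §8.2 p. 122] [cite: Shelstad1979, §4 p. 22] -/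
def chartTorusHLoc : Subgroup ↥(archLocal L 2 (Matrix.of fun i j : Fin 2 => if i.val + j.val + 1 = 2 then (1 : L) else 0) w) :=
  (endoBlockAtHom L S w).range.topologicalClosure

/-- `T_{S,w}` is closed. [cite: Shelstad1979, §4 p. 22] -/
theorem isClosed_chartTorusHLoc :
    IsClosed (chartTorusHLoc L S w : Set ↥(archLocal L 2 (Matrix.of fun i j : Fin 2 => if i.val + j.val + 1 = 2 then (1 : L) else 0) w)) :=
  Subgroup.isClosed_topologicalClosure _

/-- The range of the local chart lies in `T_{S,w}`. [cite: Rogawski1990, §3.6 p. 31] -/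
theorem range_endoBlockAtHom_le_chartTorusHLoc : (endoBlockAtHom L S w).range ≤ chartTorusHLoc L S w :=
  Subgroup.le_topologicalClosure _

/-- **Every local chart point lies in `T_{S,w}`.** [cite: Rogawski1990, §3.6 p. 31; §8.2 p. 122] -/
theorem endoBlockAt_mem_chartTorusHLoc (cw : Fin 3 → ℝ) : endoBlockAt L S w cw ∈ chartTorusHLoc L S w :=
  range_endoBlockAtHom_le_chartTorusHLoc L S w ⟨Multiplicative.ofAdd cw, rfl⟩

/-- **The `w`-block of every global chart point lies in `T_{S,w}`.** [cite: Rogawski1990, §8.2 p. 122] -/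
theorem endoBlock_mem_chartTorusHLoc (c : {w : InfinitePlace L // IsComplex w} → Fin 3 → ℝ) : endoBlock L S c w ∈ chartTorusHLoc L S w :=
  endoBlockAt_mem_chartTorusHLoc L S w (c w)

/-- The centraliser of a point is closed. [folklore] -/
private theorem isClosed_centralizer_singleton_loc {G : Type*} [Group G] [TopologicalSpace G] [IsTopologicalGroup G] [T2Space G] (t : G) :
    IsClosed (Subgroup.centralizer ({t} : Set G) : Set G) := by
  have h : (Subgroup.centralizer ({t} : Set G) : Set G) = {g : G | t * g = g * t} := by
    ext g
    simp [Subgroup.mem_centralizer_iff]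
  rw [h]
  exact isClosed_eq (continuous_const.mul continuous_id) (continuous_id.mul continuous_const)

/-- **`T_{S,w} ≤ Z(endoBlockAt S w cw)` for EVERY `cw`** (the range commutes with each local chart point and centralisers are closed). [cite: Rogawski1990, §3.6 p. 31] -/
theorem chartTorusHLoc_le_centralizer (cw : Fin 3 → ℝ) :
    chartTorusHLoc L S w ≤ Subgroup.centralizer ({endoBlockAt L S w cw} : Set _) := by
  refine Subgroup.topologicalClosure_minimal _ ?_ (isClosed_centralizer_singleton_loc _)
  rintro _ ⟨a, rfl⟩
  rw [Subgroup.mem_centralizer_iff]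
  rintro _ rfl
  rw [endoBlockAtHom_apply]
  exact endoBlockAt_comm L S w cw _

/-- **Every element of `T_{S,w}` commutes with every local chart point** — the well-definedness binder of ★ `descConj (endoBlockAt S w cw) T_{S,w} _`.
[cite: Rogawski1990, §8.2 p. 122] [cite: Shelstad1979, §4 p. 22] -/
theorem forall_mem_chartTorusHLoc_comm (cw : Fin 3 → ℝ) :
    ∀ m ∈ chartTorusHLoc L S w, m * endoBlockAt L S w cw = endoBlockAt L S w cw * m := fun _ hm =>
  ((Subgroup.mem_centralizer_iff.mp (chartTorusHLoc_le_centralizer L S w cw hm)) _ rfl).symm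

/-- The range of the local chart is commutative. [cite: Rogawski1990, §3.6 p. 31] -/
theorem range_endoBlockAtHom_mul_comm (a b : ↥(endoBlockAtHom L S w).range) : a * b = b * a := by
  obtain ⟨a, x, rfl⟩ := a
  obtain ⟨b, y, rfl⟩ := b
  apply Subtype.ext
  simp only [Subgroup.coe_mul, endoBlockAtHom_apply]
  exact endoBlockAt_comm L S w _ _

/-- **`T_{S,w}` is abelian.** [cite: Rogawski1990, §3.6 p. 31] [cite: Shelstad1979, §4 p. 22] -/
theorem chartTorusHLoc_mul_comm (a b : ↥(chartTorusHLoc L S w)) : a * b = b * a :=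
  (Subgroup.commGroupTopologicalClosure (endoBlockAtHom L S w).range (range_endoBlockAtHom_mul_comm L S w)).mul_comm a b

/-- `U(Φ₂)_w` is locally compact (★ `locallyCompactSpace_archLocal`). [cite: Folland1995, §2.2] -/
theorem locallyCompactSpace_archLocal_two : LocallyCompactSpace ↥(archLocal L 2 (Matrix.of fun i j : Fin 2 => if i.val + j.val + 1 = 2 then (1 : L) else 0) w) :=
  locallyCompactSpace_archLocal L 2 _ w

/-- `U(Φ₂)_w` is second countable (★ `secondCountableTopology_archLocal`). [cite: Folland1995, §2.2] -/
theorem secondCountableTopology_archLocal_two : SecondCountableTopology ↥(archLocal L 2 (Matrix.of fun i j : Fin 2 => if i.val + j.val + 1 = 2 then (1 : L) else 0) w) :=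
  secondCountableTopology_archLocal L 2 _ w

/-- `T_{S,w}` is locally compact (closed in the locally compact `U(Φ₂)_w`). [cite: Folland1995, §2.2] -/
theorem locallyCompactSpace_chartTorusHLoc : LocallyCompactSpace ↥(chartTorusHLoc L S w) :=
  haveI := locallyCompactSpace_archLocal_two L w
  (isClosed_chartTorusHLoc L S w).isClosedEmbedding_subtypeVal.locallyCompactSpace

/-- The local orbital integrand `x T_{S,w} ↦ f (x · endoBlockAt S w cw · x⁻¹)` is continuous for continuous `f`. [cite: Rogawski1990, §8.3 p. 124] -/
theorem continuous_descConj_endoBlockAt {Y : Type*} [TopologicalSpace Y]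
    (f : ↥(archLocal L 2 (Matrix.of fun i j : Fin 2 => if i.val + j.val + 1 = 2 then (1 : L) else 0) w) → Y) (hf : Continuous f) (cw : Fin 3 → ℝ) :
    Continuous (descConj (endoBlockAt L S w cw) (chartTorusHLoc L S w) (forall_mem_chartTorusHLoc_comm L S w cw) f) := by
  rw [(QuotientGroup.isQuotientMap_mk _).continuous_iff, descConj_comp_mk]
  exact hf.comp ((continuous_id.mul continuous_const).mul continuous_id.inv)

/-- **The local coordinate box of the chart `S` at `w`**: `x ∈ [0, 1]` in the split slot (`w ∈ S`, slot `0`), the other slots in `[0, 2π]` — the `w`-factor of ★ `chartBox S`.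
[cite: Rogawski1990, §8.2 p. 122] [cite: Folland1995, §2.2] -/
def chartBoxLoc : Set (Fin 3 → ℝ) :=
  Set.pi Set.univ fun i => Set.Icc 0 (if w ∈ S ∧ i = 0 then 1 else 2 * Real.pi)

/-- **★ `chartBox S` is the product of the local boxes** (definitional). [cite: Folland1995, §2.2] -/
theorem chartBox_eq_pi_chartBoxLoc : chartBox L S = Set.pi Set.univ (fun w => chartBoxLoc L S w) := rfl

/-- The local box is compact. [cite: Folland1995, §2.2] -/
theorem isCompact_chartBoxLoc : IsCompact (chartBoxLoc L S w) :=
  isCompact_univ_pi fun _ => isCompact_Icc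

/-- `0` lies in the local box. [cite: Folland1995, §2.2] -/
theorem zero_mem_chartBoxLoc : (0 : Fin 3 → ℝ) ∈ chartBoxLoc L S w := by
  intro i _
  simp only [Pi.zero_apply, Set.mem_Icc, le_refl, true_and]
  split_ifs
  · exact zero_le_one
  · positivity

/-- **The local box image `B_{S,w} ⊆ T_{S,w}`** — the compact set whose Haar mass normalises the local chart orbital functional (the `w`-factor of ★ `chartBoxImg S`).
[cite: Rogawski1990, §8.2 p. 122] [cite: Folland1995, §2.2] -/
def chartBoxImgLoc : Set ↥(chartTorusHLoc L S w) :=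
  (fun cw => (⟨endoBlockAt L S w cw, endoBlockAt_mem_chartTorusHLoc L S w cw⟩ : ↥(chartTorusHLoc L S w))) '' chartBoxLoc L S w

/-- `B_{S,w}` is compact. [cite: Folland1995, §2.2] -/
theorem isCompact_chartBoxImgLoc : IsCompact (chartBoxImgLoc L S w) :=
  (isCompact_chartBoxLoc L S w).image ((continuous_endoBlockAt L S w).subtype_mk _)

/-- `1 ∈ B_{S,w}`. [cite: Folland1995, §2.2] -/
theorem one_mem_chartBoxImgLoc : (1 : ↥(chartTorusHLoc L S w)) ∈ chartBoxImgLoc L S w :=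
  ⟨0, zero_mem_chartBoxLoc L S w, Subtype.ext (endoBlockAt_zero L S w)⟩

/-- Membership in `B_{S,w}` read on `U(Φ₂)_w`. [cite: Folland1995, §2.2] -/
theorem mem_chartBoxImgLoc_iff (t : ↥(chartTorusHLoc L S w)) :
    t ∈ chartBoxImgLoc L S w ↔ ∃ cw ∈ chartBoxLoc L S w, endoBlockAt L S w cw = (t : ↥(archLocal L 2 (Matrix.of fun i j : Fin 2 => if i.val + j.val + 1 = 2 then (1 : L) else 0) w)) := by
  constructor
  · rintro ⟨cw, hcw, rfl⟩
    exact ⟨cw, hcw, rfl⟩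
  · rintro ⟨cw, hcw, h⟩
    exact ⟨cw, hcw, Subtype.ext h⟩

variable [NumberField L] [IsCMField L]

/-- The coordinate family supported at `w` with slots `(cw 0, 0, cw 2)`: its global chart point has `w`-block `endoBlockAt S w cw`, trivial blocks elsewhere and
trivial `U(Φ₁)`-component. [cite: Rogawski1990, §8.2 p. 122] -/
theorem endoTorus_update_zero (cw : Fin 3 → ℝ) :
    endoTorus L S (Function.update (0 : {w : InfinitePlace L // IsComplex w} → Fin 3 → ℝ) w ![cw 0, 0, cw 2]) =
      ((archPiEquivCM 2 L (Matrix.of fun i j : Fin 2 => if i.val + j.val + 1 = 2 then (1 : L) else 0)).symm (Pi.mulSingle w (endoBlockAt L S w cw)), 1) := by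
  have h1 : endoBlock L S (Function.update (0 : {w : InfinitePlace L // IsComplex w} → Fin 3 → ℝ) w ![cw 0, 0, cw 2]) =
      Pi.mulSingle w (endoBlockAt L S w cw) := by
    funext v
    by_cases hv : v = w
    · subst hv
      rw [Pi.mulSingle_eq_same, endoBlock_eq_endoBlockAt, Function.update_self]
      exact endoBlockAt_congr L S v rfl rfl
    · rw [Pi.mulSingle_eq_of_ne hv, endoBlock_eq_endoBlockAt, Function.update_of_ne hv]
      exact endoBlockAt_zero L S v
  have h2 : endoCircle L (Function.update (0 : {w : InfinitePlace L // IsComplex w} → Fin 3 → ℝ) w ![cw 0, 0, cw 2]) = endoCircle L 0 := by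
    funext v
    apply Subtype.ext
    by_cases hv : v = w
    · subst hv
      simp only [endoCircle, Function.update_self, Pi.zero_apply]
      rfl
    · simp only [endoCircle, Function.update_of_ne hv]
  have h3 : (endoTorus L S 0).2 = 1 := by rw [endoTorus_zero]; rfl
  unfold endoTorus at h3 ⊢
  rw [h1, h2]
  exact Prod.ext rfl h3

/-- **THE RANGE OF THE LOCAL CHART IS CLOSED** — the preimage of the closed range of the GLOBAL chart (★ `isClosed_range_endoTorusHom`) under the continuous insertion
`g ↦ (e⁻¹(mulSingle w g), 1)`. [cite: Shelstad1979, §4 p. 22] [cite: Rogawski1990, §3.6 p. 31] -/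
theorem isClosed_range_endoBlockAtHom :
    IsClosed ((endoBlockAtHom L S w).range : Set ↥(archLocal L 2 (Matrix.of fun i j : Fin 2 => if i.val + j.val + 1 = 2 then (1 : L) else 0) w)) := by
  set ι : ↥(archLocal L 2 (Matrix.of fun i j : Fin 2 => if i.val + j.val + 1 = 2 then (1 : L) else 0) w) →
      ↥(arch (↥(maximalRealSubfield L)) L (IsCMField.complexConj L) 2 (Matrix.of fun i j : Fin 2 => if i.val + j.val + 1 = 2 then (1 : L) else 0)) ×
        ↥(arch (↥(maximalRealSubfield L)) L (IsCMField.complexConj L) 1 (Matrix.of fun i j : Fin 1 => if i.val + j.val + 1 = 1 then (1 : L) else 0)) :=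
    fun g => ((archPiEquivCM 2 L (Matrix.of fun i j : Fin 2 => if i.val + j.val + 1 = 2 then (1 : L) else 0)).symm (Pi.mulSingle w g), 1) with hι
  have hιc : Continuous ι :=
    ((archPiEquivCM 2 L _).symm.continuous.comp
      (_root_.continuous_mulSingle (A := fun v : {w : InfinitePlace L // IsComplex w} =>
        ↥(archLocal L 2 (Matrix.of fun i j : Fin 2 => if i.val + j.val + 1 = 2 then (1 : L) else 0) v)) w)).prodMk continuous_const
  have hset : ((endoBlockAtHom L S w).range : Set _) = ι ⁻¹' ((endoTorusHom L S).range : Set _) := by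
    ext g
    simp only [SetLike.mem_coe, Set.mem_preimage, MonoidHom.mem_range, endoBlockAtHom_apply, endoTorusHom_apply]
    constructor
    · rintro ⟨a, rfl⟩
      exact ⟨Multiplicative.ofAdd (Function.update (0 : {w : InfinitePlace L // IsComplex w} → Fin 3 → ℝ) w ![(Multiplicative.toAdd a) 0, 0, (Multiplicative.toAdd a) 2]),
        endoTorus_update_zero L S w _⟩
    · rintro ⟨a, ha⟩
      refine ⟨Multiplicative.ofAdd ((Multiplicative.toAdd a) w), ?_⟩
      have h1 := congrArg (fun h => archPiEquivCM 2 L (Matrix.of fun i j : Fin 2 => if i.val + j.val + 1 = 2 then (1 : L) else 0) h.1 w) ha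
      simp only [hι, archPiEquivCM_endoTorus_fst, ContinuousMulEquiv.apply_symm_apply, Pi.mulSingle_eq_same] at h1
      rw [← h1, endoBlock_eq_endoBlockAt]
      rfl
  rw [hset]
  exact (isClosed_range_endoTorusHom L S).preimage hιc

/-- **`chartTorusHLoc S w` IS THE RANGE OF THE LOCAL CHART** (the topological closure in its definition changed nothing). [cite: Shelstad1979, §4 p. 22] -/
theorem chartTorusHLoc_eq_range : chartTorusHLoc L S w = (endoBlockAtHom L S w).range :=
  le_antisymm (Subgroup.topologicalClosure_minimal _ le_rfl (isClosed_range_endoBlockAtHom L S w)) (range_endoBlockAtHom_le_chartTorusHLoc L S w)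

/-- **Every element of `T_{S,w}` is a local chart point.** [cite: Rogawski1990, §3.6 p. 31; §8.2 p. 122] -/
theorem mem_chartTorusHLoc_iff (g : ↥(archLocal L 2 (Matrix.of fun i j : Fin 2 => if i.val + j.val + 1 = 2 then (1 : L) else 0) w)) :
    g ∈ chartTorusHLoc L S w ↔ ∃ cw : Fin 3 → ℝ, endoBlockAt L S w cw = g := by
  rw [chartTorusHLoc_eq_range]
  exact ⟨fun ⟨a, ha⟩ => ⟨Multiplicative.toAdd a, ha⟩, fun ⟨cw, hcw⟩ => ⟨Multiplicative.ofAdd cw, hcw⟩⟩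

/-! ## §3 The chart torus `T_S` is placewise -/

/-- **THE CHART TORUS IS PLACEWISE**: `h ∈ T_S` iff the `w`-block of `h.1` lies in the local torus `T_{S,w}` for every `w` — NO condition on the `U(Φ₁)`-component `h.2`
(every element of `U(Φ₁)_w = U(1)` is `e^{iφ}`, ★ `exists_eq_circleDiagonal_one`).  The algebraic half of «`T_S = (Π_w T_{S,w}) × U(Φ₁)_∞`».
[cite: Rogawski1990, §3.6 p. 31; §4.9 p. 54; §8.2 p. 122] [cite: BorelJacquet1979, §4.1] -/
theorem mem_chartTorusH_iff_forall_mem_chartTorusHLoc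
    (h : ↥(arch (↥(maximalRealSubfield L)) L (IsCMField.complexConj L) 2 (Matrix.of fun i j : Fin 2 => if i.val + j.val + 1 = 2 then (1 : L) else 0)) ×
      ↥(arch (↥(maximalRealSubfield L)) L (IsCMField.complexConj L) 1 (Matrix.of fun i j : Fin 1 => if i.val + j.val + 1 = 1 then (1 : L) else 0))) :
    h ∈ chartTorusH L S ↔
      ∀ w : {w : InfinitePlace L // IsComplex w},
        archPiEquivCM 2 L (Matrix.of fun i j : Fin 2 => if i.val + j.val + 1 = 2 then (1 : L) else 0) h.1 w ∈ chartTorusHLoc L S w := by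
  rw [mem_chartTorusH_iff]
  constructor
  · rintro ⟨c, rfl⟩ w
    rw [archPiEquivCM_endoTorus_fst]
    exact endoBlock_mem_chartTorusHLoc L S w c
  · intro hw
    have hc : ∀ w : {w : InfinitePlace L // IsComplex w}, ∃ cw : Fin 3 → ℝ,
        endoBlockAt L S w cw = archPiEquivCM 2 L (Matrix.of fun i j : Fin 2 => if i.val + j.val + 1 = 2 then (1 : L) else 0) h.1 w := fun w =>
      (mem_chartTorusHLoc_iff L S w _).1 (hw w)
    choose cw hcw using hc
    have hφ : ∀ w : {w : InfinitePlace L // IsComplex w}, ∃ φ : ℝ,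
        ((archPiEquivCM 1 L (Matrix.of fun i j : Fin 1 => if i.val + j.val + 1 = 1 then (1 : L) else 0) h.2 w :
          ↥(archLocal L 1 (Matrix.of fun i j : Fin 1 => if i.val + j.val + 1 = 1 then (1 : L) else 0) w)) : GL (Fin 1) ℂ) = circleDiagonal 1 ![Circle.exp φ] := fun w =>
      exists_eq_circleDiagonal_one L w _
    choose φ hφ using hφ
    refine ⟨fun w => ![cw w 0, φ w, cw w 2], ?_⟩
    refine Prod.ext ?_ ?_
    · apply (archPiEquivCM 2 L (Matrix.of fun i j : Fin 2 => if i.val + j.val + 1 = 2 then (1 : L) else 0)).injective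
      funext w
      rw [archPiEquivCM_endoTorus_fst, ← hcw w, endoBlock_eq_endoBlockAt]
      exact endoBlockAt_congr L S w rfl rfl
    · apply (archPiEquivCM 1 L (Matrix.of fun i j : Fin 1 => if i.val + j.val + 1 = 1 then (1 : L) else 0)).injective
      funext w
      rw [archPiEquivCM_endoTorus_snd]
      apply Subtype.ext
      rw [hφ w]
      rfl

/-- The `w`-block of an element of `T_S` lies in `T_{S,w}`. [cite: Rogawski1990, §8.2 p. 122] -/
theorem archPiEquivCM_fst_mem_chartTorusHLoc {h : ↥(arch (↥(maximalRealSubfield L)) L (IsCMField.complexConj L) 2 (Matrix.of fun i j : Fin 2 => if i.val + j.val + 1 = 2 then (1 : L) else 0)) ×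
      ↥(arch (↥(maximalRealSubfield L)) L (IsCMField.complexConj L) 1 (Matrix.of fun i j : Fin 1 => if i.val + j.val + 1 = 1 then (1 : L) else 0))}
    (hh : h ∈ chartTorusH L S) (w : {w : InfinitePlace L // IsComplex w}) :
    archPiEquivCM 2 L (Matrix.of fun i j : Fin 2 => if i.val + j.val + 1 = 2 then (1 : L) else 0) h.1 w ∈ chartTorusHLoc L S w :=
  (mem_chartTorusH_iff_forall_mem_chartTorusHLoc L S h).1 hh w

/-- **The `U(Φ₁)`-component of `T_S` is unconstrained**: `(a, b) ∈ T_S ↔ (a, b′) ∈ T_S`. [cite: Rogawski1990, §4.9 p. 54] -/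
theorem mem_chartTorusH_iff_of_fst_eq
    (a : ↥(arch (↥(maximalRealSubfield L)) L (IsCMField.complexConj L) 2 (Matrix.of fun i j : Fin 2 => if i.val + j.val + 1 = 2 then (1 : L) else 0)))
    (b b' : ↥(arch (↥(maximalRealSubfield L)) L (IsCMField.complexConj L) 1 (Matrix.of fun i j : Fin 1 => if i.val + j.val + 1 = 1 then (1 : L) else 0))) :
    (a, b) ∈ chartTorusH L S ↔ (a, b') ∈ chartTorusH L S := by
  rw [mem_chartTorusH_iff_forall_mem_chartTorusHLoc, mem_chartTorusH_iff_forall_mem_chartTorusHLoc]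

/-- In particular `(1, b) ∈ T_S` for every `b ∈ U(Φ₁)_∞`: **the whole `U(Φ₁)`-factor lies in the chart torus.** [cite: Rogawski1990, §4.9 p. 54] -/
theorem one_prod_mem_chartTorusH (b : ↥(arch (↥(maximalRealSubfield L)) L (IsCMField.complexConj L) 1 (Matrix.of fun i j : Fin 1 => if i.val + j.val + 1 = 1 then (1 : L) else 0))) :
    ((1 : ↥(arch (↥(maximalRealSubfield L)) L (IsCMField.complexConj L) 2 (Matrix.of fun i j : Fin 2 => if i.val + j.val + 1 = 2 then (1 : L) else 0))), b) ∈ chartTorusH L S := by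
  rw [mem_chartTorusH_iff_of_fst_eq L S 1 b 1]
  exact (chartTorusH L S).one_mem

end LocalTorus

end Literature.NumberTheory.Automorphic.UnitaryGroup

end
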